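import Mathlib
import Summits.MatrixMultiplication.MatrixMultiplication.Theses.LevelGradedCohnUmans
import Summits.MatrixMultiplication.MatrixMultiplication.Theorems.LieRankDesigns.Negative.Basics

/-!
# Stub `stub_rankSep_of_singleLine` — line `Sketch` of the crux `LevelOneGL2Designs`
(stmt-MatrixMultiplication-14080)

**Single-line separators.**  Fix a target `(x₀, z₀)`, a non-zero vector `v` and put
`w := (x₀⁻¹ z₀) v`.  The indicator `g ↦ 1[g v = w]` on `GL₂(𝔽_p)` is a level-one test function:

  `1[g v = w] = p⁻² Σ_ξ ψ(ξ ⬝ (g v − w)) = Σ_ξ (p⁻² ψ(−ξ ⬝ w)) · ψ(tr((v ξᵀ) g))`,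

because `tr((v ξᵀ) g) = ξ ⬝ (g v)` and `Σ_{ξ ∈ 𝔽_p²} ψ(ξ ⬝ u) = p² · 1[u = 0]` (orthogonality of
the standard additive character `ψ = ZMod.stdAddChar`), while every `v ξᵀ = vecMulVec v ξ` has rank
`≤ 1` (`Matrix.rank_vecMulVec_le`).  Hence, if the based quadruple products `x⁻¹ y y'⁻¹ z` move `v`
to `w` only in the trivial case `x = x₀, y = y', z = z₀`, this test function separates the target,
which is `RankSep 1 X Y Z`.
-/

set_option linter.dupNamespace false

noncomputable section

open scoped BigOperators

namespace Summit.MatrixMultiplication.MatrixMultiplication.Theorems.LevelOneGL2Designs.FlagLine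

open Summit.MatrixMultiplication.MatrixMultiplication.Theses.LevelGradedCohnUmans
open Summit.MatrixMultiplication.MatrixMultiplication.Theorems.LieRankDesigns.Negative

section Separation

variable {p : ℕ} [Fact p.Prime]

/-- One-variable orthogonality of the standard additive character of `𝔽_p`:
`Σ_a ψ(a b) = p · 1[b = 0]`. [folklore] -/
private theorem sum_stdAddChar_mul_eq (b : ZMod p) :
    ∑ a : ZMod p, ZMod.stdAddChar (a * b) = if b = 0 then (p : ℂ) else 0 := by
  rw [AddChar.sum_mulShift b (ZMod.isPrimitive_stdAddChar p), ZMod.card, Nat.cast_ite,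
    Nat.cast_zero]

/-- Two-variable orthogonality: `Σ_{ξ ∈ 𝔽_p²} ψ(ξ ⬝ u) = p² · 1[u = 0]`. [folklore] -/
private theorem sum_stdAddChar_dotProduct_eq (u : Fin 2 → ZMod p) :
    ∑ ξ : Fin 2 → ZMod p, ZMod.stdAddChar (ξ ⬝ᵥ u) = if u = 0 then (p : ℂ) ^ 2 else 0 := by
  have h1 : ∀ ξ : Fin 2 → ZMod p,
      ZMod.stdAddChar (ξ ⬝ᵥ u) = ∏ i : Fin 2, ZMod.stdAddChar (ξ i * u i) := by
    intro ξ
    rw [dotProduct, Fin.sum_univ_two, Fin.prod_univ_two, AddChar.map_add_eq_mul]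
  have h2 : ∏ i : Fin 2, ∑ a : ZMod p, ZMod.stdAddChar (a * u i)
      = ∑ ξ : Fin 2 → ZMod p, ∏ i : Fin 2, ZMod.stdAddChar (ξ i * u i) :=
    Fintype.prod_sum fun i a => ZMod.stdAddChar (a * u i)
  simp_rw [h1]
  rw [← h2]
  simp_rw [sum_stdAddChar_mul_eq]
  by_cases hu : u = 0
  · subst hu
    simp
  · obtain ⟨i, hi⟩ := Function.ne_iff.mp hu
    have hi' : u i ≠ 0 := hi
    rw [if_neg hu]
    exact Finset.prod_eq_zero (Finset.mem_univ i) (if_neg hi')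

/-- `tr((v ξᵀ) M) = ξ ⬝ (M v)`. [folklore] -/
private theorem trace_vecMulVec_mul_eq (v ξ : Fin 2 → ZMod p) (M : Mat p 2) :
    Matrix.trace (Matrix.vecMulVec v ξ * M) = ξ ⬝ᵥ M.mulVec v := by
  rw [Matrix.vecMulVec_mul, Matrix.trace_vecMulVec, dotProduct_comm, Matrix.dotProduct_mulVec]

/-- **The line coefficient table.**  For vectors `v, w ∈ 𝔽_p²` the table
`c M = Σ_ξ 1[M = v ξᵀ] · p⁻² ψ(−ξ ⬝ w)` is supported on matrices of rank `≤ 1` and its Fourier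
function is the indicator `g ↦ 1[g v = w]`. [folklore] -/
private theorem exists_lineCoeff (v w : Fin 2 → ZMod p) :
    ∃ c : Mat p 2 → ℂ, RankSupp 1 c ∧
      ∀ g : GLm p 2, fourierFn c g = if (g : Mat p 2).mulVec v = w then 1 else 0 := by
  refine ⟨fun M => ∑ ξ : Fin 2 → ZMod p,
      if M = Matrix.vecMulVec v ξ then ((p : ℂ) ^ 2)⁻¹ * ZMod.stdAddChar (-(ξ ⬝ᵥ w)) else 0,
    ?_, ?_⟩
  · -- rank support: `rk (v ξᵀ) ≤ 1`, so every summand vanishes on matrices of rank `> 1`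
    intro M hM
    refine Finset.sum_eq_zero fun ξ _ => if_neg ?_
    rintro rfl
    exact absurd (Matrix.rank_vecMulVec_le v ξ) (not_le.mpr hM)
  · -- the Fourier function is the indicator of `g v = w`
    intro g
    have hp : (p : ℂ) ≠ 0 := Nat.cast_ne_zero.mpr (Fact.out : p.Prime).ne_zero
    unfold fourierFn
    simp_rw [Finset.sum_mul, ite_mul, zero_mul]
    rw [Finset.sum_comm]
    simp_rw [Fintype.sum_ite_eq', trace_vecMulVec_mul_eq, mul_assoc, ← AddChar.map_add_eq_mul,
      neg_add_eq_sub, ← dotProduct_sub, ← Finset.mul_sum, sum_stdAddChar_dotProduct_eq]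
    by_cases hg : (g : Mat p 2).mulVec v = w
    · rw [if_pos (sub_eq_zero.mpr hg), if_pos hg, inv_mul_cancel₀ (pow_ne_zero 2 hp)]
    · rw [if_neg fun h0 => hg (sub_eq_zero.mp h0), if_neg hg, mul_zero]

/-- **Single-line separators.**  The level-one test `g ↦ 1[g·v = (x₀⁻¹z₀)·v]` has Fourier rank
`≤ 1` (`1[gv = w] = p⁻² Σ_ξ ψ(−ξ·w) ψ(tr((v ξᵀ) g))`, `rk(v ξᵀ) ≤ 1`), and it separates the target
`(x₀, z₀)` as soon as the based products `x₀x⁻¹·yy'⁻¹·zz₀⁻¹` fix the non-zero vector `z₀v` only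
trivially — TPP modulo the stabiliser of one vector. -/
theorem stub_rankSep_of_singleLine (X Y Z : Finset (GLm p 2))
    (h : ∀ x₀ ∈ X, ∀ z₀ ∈ Z, ∃ v : Fin 2 → ZMod p, v ≠ 0 ∧
      ∀ x ∈ X, ∀ y ∈ Y, ∀ y' ∈ Y, ∀ z ∈ Z,
        ((x⁻¹ * y * y'⁻¹ * z : GLm p 2) : Mat p 2).mulVec v
          = ((x₀⁻¹ * z₀ : GLm p 2) : Mat p 2).mulVec v → x = x₀ ∧ y = y' ∧ z = z₀) :
    RankSep 1 X Y Z := by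
  intro x₀ hx₀ z₀ hz₀
  obtain ⟨v, -, hsep⟩ := h x₀ hx₀ z₀ hz₀
  obtain ⟨c, hc, hcf⟩ := exists_lineCoeff v (((x₀⁻¹ * z₀ : GLm p 2) : Mat p 2).mulVec v)
  refine ⟨c, hc, fun x hx y hy y' hy' z hz => ?_⟩
  rw [hcf]
  by_cases hq : x = x₀ ∧ y = y' ∧ z = z₀
  · rw [if_pos hq]
    obtain ⟨hxx, hyy, hzz⟩ := hq
    rw [hxx, hyy, hzz, mul_inv_cancel_right, if_pos rfl]
  · rw [if_neg hq, if_neg fun hgv => hq (hsep x hx y hy y' hy' z hz hgv)]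

end Separation

end Summit.MatrixMultiplication.MatrixMultiplication.Theorems.LevelOneGL2Designs.FlagLine
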